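import Summits.BirchSwinnertonDyer.BirchSwinnertonDyer.Theorems.SignedLowerHalvesSprungLowerDivisibilityAtThreeSqueezeToCommonZeros
import Summits.BirchSwinnertonDyer.BirchSwinnertonDyer.Theorems.SignedLowerHalvesSprungLowerDivisibilityAtThreeStubPeriodMu
import Summits.BirchSwinnertonDyer.BirchSwinnertonDyer.Theorems.SignedLowerHalvesSprungLowerDivisibilityAtThreeRankZeroCommonZeros
import Summits.BirchSwinnertonDyer.Rank1Residual.Supersingular.SignedOrderOfVanishing
import Literature.NumberTheory.EllipticCurves.Sprung2024.ChromaticSmallControlSurjProofs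
import Literature.NumberTheory.EllipticCurves.LeadingTermPPartProofs
import Literature.NumberTheory.EllipticCurves.PAdicBSDKatoFiniteProofs
import Literature.NumberTheory.EllipticCurves.MordellWeilRankZeroProofs
import Literature.NumberTheory.EllipticCurves.LeadingTerm
import HarnessLib

/-!
# Crux K1 `SprungLowerDivisibilityAtThree` (item stmt-BirchSwinnertonDyer-19875), line `chromatic-common-zeros`:
# stub S4 at the prime `(T)` — the CONTROL brick (`T ∣ gen char X^•` at analytic rank one, Sprung's REAL datum)
# and the two cheap cases of S4 at `(T)`: analytic rank zero (vacuous) and a colour with a simple zero at `T`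

Cell `bsd-ssimc` (host) / lead `cruxlead-stmt-BirchSwinnertonDyer-19875`, width seat w3; `--supports` 19875 (helper);
theorems only; closes NO item; K1 / BSD / leaf X8 are NOT proved by anything here.

## What this file proves (bricks for the lead's split S4 = S4a `(T) ∧ r_an ≤ 1` + S4b)

Stub S4 `stub_cyclotomicLower` (skeleton `Cruxes/SprungLowerDivisibilityAtThree/Lines/chromatic_common_zeros.lean`, lead's
reshape sha16 cea29801) asks, at a CYCLOTOMIC COMMON height-one prime `𝔭` of `Λ = ℤ₃⟦T⟧`, for the local Eisenstein
inequality `ℓ_𝔭 Λ/(G^•) ≤ ℓ_𝔭 X^•` on Sprung's REAL dual Selmer datum `D` (binders `[Module.Finite Λ D.X]`,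
`Module.IsTorsion Λ D.X` = Thm. 7.14's output). At `𝔭 = (T)`:
* §1 `X_dvd_charGen_of_analyticRank_eq_one` — **CONTROL, Selmer side of S4a**: on an X8 pair with `r_an = 1`,
  `T ∣ gen` for every generator of `char_Λ D.X` — GZK (`hGZK : rank_eq_analyticRank_of_analyticRank_le_one`, named,
  published) gives `rank E(ℚ) = 1`, so `Sel_{3^∞}(E/ℚ)` is infinite; the KERNEL THEOREM
  `Sprung2024.lem56AllN_sharpFlat_finite_selmer_of_finite_coinvariants_holds` (Sprung 2024 Lemma 5.6, surjectivity
  half, discharged in tree) turns «`X^•/TX^•` finite» into «`Sel_{3^∞}(E/ℚ)` finite», and Greenberg's Lemma 4.2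
  (`IwasawaAlgebra.finite_coinvariants_of_constantCoeff_ne_zero`) turns `gen(0) ≠ 0` into «`X^•/TX^•` finite»; hence
  `gen(0) = 0`. Length form `one_le_lengthAt_of_analyticRank_eq_one`: `1 ≤ ℓ_𝔭 D.X` at every height-one `𝔭 ∋ T`
  (such a `𝔭` is `(T)`). No certificate, no image hypothesis, no Kato divisibility.
* §2 `stub_cyclotomicLower_at_T_of_lengthAt_le_one` — hence S4's inequality at `𝔭 ∋ T`, `r_an = 1`, for every colour
  whose normalised `G^•` has `ℓ_𝔭 Λ/(G^•) ≤ 1` (a zero of order `≤ 1` at `T`); and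
  `stub_cyclotomicLower_at_T_of_cert` — the same from the census certificate `(μ, λ)(L^•) = (0, 1)` (then
  `L^• = T·u`, `u ∈ Λˣ`, by `X8.chromaticL_eq_X_mul_unit_of_analyticRank_eq_one`, and `(G^•) = (T)` since `ϖ ∈ ℤ₃ˣ`,
  `h3`). Class-wide, the analytic input «some colour has a simple zero at `T` when `r_an = 1`» is the part of S4a the
  lead names (Kobayashi 2013 Cor. 1.3 (i) through Sprung's `𝓛og`); with it and the colour transfer of
  `Theorems/…ColourTransfer.lean` (w2), S4 at `(T)` follows for BOTH colours at `r_an = 1`.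
* §3 `stub_cyclotomicLower_at_T_of_analyticRank_eq_zero` — at `r_an = 0` the hypothesis «`(T)` is a common zero» is
  contradictory (`ChromaticCommonZerosRankZero.normalised_notMem_of_X_mem`), so S4 at `𝔭 ∋ T` holds vacuously.

References: [Sprung2024] §5.2 Lemma 5.6 (p. 41); [GreenbergLNM1716] §4 Lemma 4.2 (p. 103); [GrossZagier1986] Thm. (7.3);
[Kolyvagin1990] Thm. A; [Sprung2012] Thm. 7.14 (p. 1504), Prop. 7.19 (p. 1505); [Sprung2017] Thm. 1.12, Cor. 4.11;
[Kobayashi2013] Cor. 1.3 (i); [Washington1997] §13.2.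
-/

set_option linter.dupNamespace false
set_option autoImplicit false

noncomputable section

open scoped Classical NumberField MatrixGroups ModularForm

open NumberField IsDedekindDomain CongruenceSubgroup WeierstrassCurve Field
  Literature.NumberTheory.EllipticCurves Literature.NumberTheory.EllipticCurves.ModularForms
  Literature.NumberTheory.EllipticCurves.ZpExtension Literature.NumberTheory.EllipticCurves.Sprung2017
  Literature.NumberTheory.EllipticCurves.Sprung2012 Literature.NumberTheory.EllipticCurves.Sprung2024
  Literature.NumberTheory.EllipticCurves.Rank1Residual
  Literature.NumberTheory.EllipticCurves.GreenbergVatsal2000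
  Summit.BirchSwinnertonDyer.Rank1Residual.X1.MuLambda
  Summit.BirchSwinnertonDyer.Rank1Residual.Supersingular
  Summit.BirchSwinnertonDyer.BirchSwinnertonDyer.Theorems

namespace Summit.BirchSwinnertonDyer.BirchSwinnertonDyer.Theorems.ChromaticCommonZerosControlAtT

/-! ### §1 CONTROL at `(T)`: `T ∣ gen(char X^•)` at analytic rank one, real datum -/

/-- `r_an = 1` ⇒ `Sel_{p^∞}(E/ℚ)` is infinite (GZK: `rank E(ℚ) = 1`; a finite `p^∞`-Selmer group forces finitely
many rational points, `finite_point_of_finite_selmerGroupPInfty`, i.e. rank `0`). [cite: GrossZagier1986, Thm. (7.3)]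
[cite: Kolyvagin1990, Thm. A] -/
theorem not_finite_selmerGroupPInfty_of_analyticRank_eq_one
    (hGZK : rank_eq_analyticRank_of_analyticRank_le_one)
    (W : WeierstrassCurve ℚ) [W.IsElliptic] (p : ℕ) [Fact p.Prime] (h1 : W.analyticRank = 1) :
    ¬ Finite (W.selmerGroupPInfty p) := by
  intro hfin
  have hrank : W.mordellWeilRank = 1 := (hGZK W (by omega)).1.trans h1
  haveI := hfin
  haveI : Finite W.toAffine.Point := W.finite_point_of_finite_selmerGroupPInfty p
  have h0 : W.mordellWeilRank = 0 := W.mordellWeilRank_eq_zero_iff_finite.mpr ‹_›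
  omega

/-- **CONTROL at `(T)` (Selmer side of S4a): at analytic rank one, `T` divides every generator of `char_Λ X^•`,
Sprung's REAL datum, any colour, any image.** On an X8 pair with `W.analyticRank = 1`, in the cyclotomic/Honda
setting of K1, for a dual datum `D` of `Sel^•(E/ℚ_∞)` that is finitely generated `Λ`-torsion and `char D.X = (gen)`:
`T ∣ gen`. Proof: were `gen(0) ≠ 0`, `X^•/TX^•` would be finite (Greenberg Lemma 4.2,
`IwasawaAlgebra.finite_coinvariants_of_constantCoeff_ne_zero`), hence `Sel_{3^∞}(E/ℚ)` finite by the kernel theorem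
`lem56AllN_sharpFlat_finite_selmer_of_finite_coinvariants_holds` (Sprung 2024 Lemma 5.6), contradicting GZK.
[cite: Sprung2024, §5.2 Lemma 5.6 (p. 41)] [cite: GreenbergLNM1716, §4 Lemma 4.2 (p. 103)]
[cite: GrossZagier1986, Thm. (7.3)] [cite: Kolyvagin1990, Thm. A] -/
theorem X_dvd_charGen_of_analyticRank_eq_one (hGZK : rank_eq_analyticRank_of_analyticRank_le_one)
    (W : WeierstrassCurve ℚ) [W.IsElliptic] [W.IsGloballyMinimal] (p : ℕ) [Fact p.Prime]
    (hX : ClassX8 W p) (h1 : W.analyticRank = 1)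
    (κ : ZpExtension ℚ p) (γ : Field.absoluteGaloisGroup ℚ) (hκ : κ.IsCyclotomic) (hγ : κ.IsTopGenerator γ)
    (hcv : IsCyclotomicVariable p γ) (v : HeightOneSpectrum (𝓞 ℚ)) (hv : (p : 𝓞 ℚ) ∈ v.asIdeal)
    (g : Field.absoluteGaloisGroup (v.adicCompletion ℚ))
    (hg : κ.IsTopGenerator (resGalOfEmb (closureEmb (K := ℚ) (v.adicCompletion ℚ)) g))
    (cneg : localPoints W (v.adicCompletion ℚ)) (c : ℕ → localPoints W (v.adicCompletion ℚ))
    (hH : IsHondaSystem κ (closureEmb (K := ℚ) (v.adicCompletion ℚ)) W (W.frobeniusTrace p) g cneg c)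
    (col : Chroma)
    (D : SharpFlatSelmerDualData W κ γ (closureEmb (K := ℚ) (v.adicCompletion ℚ)) (W.frobeniusTrace p) g c col)
    [Module.Finite (IwasawaAlgebra p) D.X] (hXt : Module.IsTorsion (IwasawaAlgebra p) D.X)
    {gen : IwasawaAlgebra p} (hgen : D.charIdeal = Ideal.span {gen}) :
    (PowerSeries.X : IwasawaAlgebra p) ∣ gen := by
  obtain ⟨hp3, ⟨hgood, hap⟩, -⟩ := hX
  subst hp3
  have hp2 : (3 : ℕ) ≠ 2 := by decide
  rw [PowerSeries.X_dvd_iff]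
  by_contra h0
  refine not_finite_selmerGroupPInfty_of_analyticRank_eq_one hGZK W 3 h1
    (lem56AllN_sharpFlat_finite_selmer_of_finite_coinvariants_holds W 3 hp2 hgood hap κ γ hκ hγ hcv v hv g
      hg cneg c hH col D ?_)
  exact IwasawaAlgebra.finite_coinvariants_of_constantCoeff_ne_zero 3 D.X hXt gen
    (by rw [show Module.charIdeal (IwasawaAlgebra 3) D.X = D.charIdeal from rfl, hgen]
        exact Ideal.mem_span_singleton_self gen) h0

/-- **Length form of CONTROL at `(T)`**: at analytic rank one, `1 ≤ ℓ_𝔭 X^•` at every height-one prime `𝔭 ∋ T`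
(that prime is `(T)`; `char X^• = (T·g')` and the characteristic ideal determines the height-one lengths,
`SkinnerUrban2014.lengthAt_eq_of_charIdeal_eq`). Sprung's REAL datum; any colour; any image.
[cite: Sprung2024, §5.2 Lemma 5.6 (p. 41)] [cite: GreenbergLNM1716, §4 Lemma 4.2 (p. 103)] [cite: Washington1997, §13.2] -/
theorem one_le_lengthAt_of_analyticRank_eq_one (hGZK : rank_eq_analyticRank_of_analyticRank_le_one)
    (W : WeierstrassCurve ℚ) [W.IsElliptic] [W.IsGloballyMinimal] (p : ℕ) [Fact p.Prime]
    (hX : ClassX8 W p) (h1 : W.analyticRank = 1)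
    (κ : ZpExtension ℚ p) (γ : Field.absoluteGaloisGroup ℚ) (hκ : κ.IsCyclotomic) (hγ : κ.IsTopGenerator γ)
    (hcv : IsCyclotomicVariable p γ) (v : HeightOneSpectrum (𝓞 ℚ)) (hv : (p : 𝓞 ℚ) ∈ v.asIdeal)
    (g : Field.absoluteGaloisGroup (v.adicCompletion ℚ))
    (hg : κ.IsTopGenerator (resGalOfEmb (closureEmb (K := ℚ) (v.adicCompletion ℚ)) g))
    (cneg : localPoints W (v.adicCompletion ℚ)) (c : ℕ → localPoints W (v.adicCompletion ℚ))
    (hH : IsHondaSystem κ (closureEmb (K := ℚ) (v.adicCompletion ℚ)) W (W.frobeniusTrace p) g cneg c)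
    (col : Chroma)
    (D : SharpFlatSelmerDualData W κ γ (closureEmb (K := ℚ) (v.adicCompletion ℚ)) (W.frobeniusTrace p) g c col)
    [Module.Finite (IwasawaAlgebra p) D.X] (hXt : Module.IsTorsion (IwasawaAlgebra p) D.X)
    (𝔭 : PrimeSpectrum (IwasawaAlgebra p)) (h𝔭 : 𝔭.asIdeal.height = 1)
    (hT : (PowerSeries.X : IwasawaAlgebra p) ∈ 𝔭.asIdeal) :
    1 ≤ Module.lengthAt (IwasawaAlgebra p) D.X 𝔭 := by
  classical
  -- a generator of `char D.X`, divisible by `T`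
  obtain ⟨gen, hgen'⟩ := (charIdeal_isPrincipal_holds p D.X).principal
  have hgen : D.charIdeal = Ideal.span {gen} := hgen'
  obtain ⟨g', hg'⟩ := X_dvd_charGen_of_analyticRank_eq_one hGZK W p hX h1 κ γ hκ hγ hcv v hv g hg cneg c hH
    col D hXt hgen
  have hgen0 : gen ≠ 0 := by
    intro h0
    apply Module.charIdeal_ne_bot (IwasawaAlgebra p) D.X
    rw [show Module.charIdeal (IwasawaAlgebra p) D.X = D.charIdeal from rfl, hgen, h0,
      Ideal.span_singleton_eq_bot]
  have hg'0 : g' ≠ 0 := fun h => hgen0 (by rw [hg', h, mul_zero])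
  -- the characteristic ideal determines the height-one lengths: `ℓ_𝔭 D.X = ℓ_𝔭 Λ/(gen)`
  have hQt : Module.IsTorsion (IwasawaAlgebra p) (IwasawaAlgebra p ⧸ Ideal.span {gen}) := by
    intro q
    refine ⟨⟨gen, mem_nonZeroDivisors_of_ne_zero hgen0⟩, ?_⟩
    have hTB : Module.IsTorsionBy (IwasawaAlgebra p) (IwasawaAlgebra p ⧸ Ideal.span {gen}) gen :=
      (Module.isTorsionBy_quotient_iff _ _).mpr fun x =>
        Ideal.mul_mem_right x _ (Ideal.mem_span_singleton_self gen)
    exact @hTB q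
  have hchar' : Module.charIdeal (IwasawaAlgebra p) D.X =
      Module.charIdeal (IwasawaAlgebra p) (IwasawaAlgebra p ⧸ Ideal.span {gen}) := by
    rw [show Module.charIdeal (IwasawaAlgebra p) D.X = D.charIdeal from rfl, hgen,
      Module.charIdeal_eq_span_of_lengthAt_eq_quotient hgen0 (fun _ _ => rfl)]
  rw [SkinnerUrban2014.lengthAt_eq_of_charIdeal_eq hXt hQt hchar' 𝔭 h𝔭, hg',
    Module.lengthAt_quotient_span_singleton_mul g' (PowerSeries.X_ne_zero) 𝔭,
    Module.lengthAt_quotient_span_singleton PowerSeries.X_prime 𝔭 h𝔭, if_pos hT]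
  exact le_self_add

/-! ### §2 S4 at `(T)`, analytic rank one, for a colour with a zero of order `≤ 1` at `T` -/

/-- **S4 at `𝔭 ∋ T`, `r_an = 1`, for a colour whose normalised `G^•` has `ℓ_𝔭 Λ/(G^•) ≤ 1`** (a zero of order
`≤ 1` at `T`): the local Eisenstein inequality `ℓ_𝔭 Λ/(G^•) ≤ ℓ_𝔭 D.X` holds by CONTROL
(`one_le_lengthAt_of_analyticRank_eq_one`). Binders: the cyclotomic/Honda setting, the REAL f.g. torsion datum `D`,
GZK; no certificate on the Selmer side, no image hypothesis. [cite: Sprung2024, §5.2 Lemma 5.6 (p. 41)]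
[cite: GreenbergLNM1716, §4 Lemma 4.2 (p. 103)] [cite: Sprung2012, Prop. 7.19 (p. 1505)] -/
theorem stub_cyclotomicLower_at_T_of_lengthAt_le_one (hGZK : rank_eq_analyticRank_of_analyticRank_le_one)
    (W : WeierstrassCurve ℚ) [W.IsElliptic] [W.IsGloballyMinimal] (p : ℕ) [Fact p.Prime]
    (hX : ClassX8 W p) (h1 : W.analyticRank = 1)
    (κ : ZpExtension ℚ p) (γ : Field.absoluteGaloisGroup ℚ) (hκ : κ.IsCyclotomic) (hγ : κ.IsTopGenerator γ)
    (hcv : IsCyclotomicVariable p γ) (v : HeightOneSpectrum (𝓞 ℚ)) (hv : (p : 𝓞 ℚ) ∈ v.asIdeal)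
    (g : Field.absoluteGaloisGroup (v.adicCompletion ℚ))
    (hg : κ.IsTopGenerator (resGalOfEmb (closureEmb (K := ℚ) (v.adicCompletion ℚ)) g))
    (cneg : localPoints W (v.adicCompletion ℚ)) (c : ℕ → localPoints W (v.adicCompletion ℚ))
    (hH : IsHondaSystem κ (closureEmb (K := ℚ) (v.adicCompletion ℚ)) W (W.frobeniusTrace p) g cneg c)
    (col : Chroma)
    (D : SharpFlatSelmerDualData W κ γ (closureEmb (K := ℚ) (v.adicCompletion ℚ)) (W.frobeniusTrace p) g c col)
    [Module.Finite (IwasawaAlgebra p) D.X] (hXt : Module.IsTorsion (IwasawaAlgebra p) D.X)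
    (G : IwasawaAlgebra p) (𝔭 : PrimeSpectrum (IwasawaAlgebra p)) (h𝔭 : 𝔭.asIdeal.height = 1)
    (hT : (PowerSeries.X : IwasawaAlgebra p) ∈ 𝔭.asIdeal)
    (hord : Module.lengthAt (IwasawaAlgebra p) (IwasawaAlgebra p ⧸ Ideal.span {G}) 𝔭 ≤ 1) :
    Module.lengthAt (IwasawaAlgebra p) (IwasawaAlgebra p ⧸ Ideal.span {G}) 𝔭 ≤
      Module.lengthAt (IwasawaAlgebra p) D.X 𝔭 :=
  hord.trans (one_le_lengthAt_of_analyticRank_eq_one hGZK W p hX h1 κ γ hκ hγ hcv v hv g hg cneg c hH col D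
    hXt 𝔭 h𝔭 hT)

/-- **The certificate case**: on an X8 pair with `r_an = 1`, a colour `•` with census certificate
`(μ, λ)(L^•) = (0, 1)` has `L^• = T · u`, `u ∈ Λˣ` (`X8.chromaticL_eq_X_mul_unit_of_analyticRank_eq_one`), and its
Néron normalisation `G^•` (`ι G^• = C(ϖ)·ι L^•`, `ϖ ∈ ℤ₃ˣ` by the held period fact `h3`) generates `(T)`; so
`ℓ_𝔭 Λ/(G^•) ≤ 1` at every height-one `𝔭` (`= 1` exactly at `𝔭 = (T)`). [cite: Sprung2017, Thm. 1.12 and Cor. 4.11]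
[cite: GreenbergVatsal2000, §3, Remark 3.4] [cite: Washington1997, §13.2] -/
theorem lengthAt_quotient_normalised_le_one_of_cert (h3 : realPeriodRat_eq_unit_mul_plusPeriod_three)
    (W : WeierstrassCurve ℚ) [W.IsElliptic] [W.IsGloballyMinimal] (p : ℕ) [Fact p.Prime]
    (hX : ClassX8 W p) (h1 : W.analyticRank = 1) {N : ℕ} [NeZero N] {f : CuspForm (Gamma0 N) 2}
    (hf : IsNewformOf W f) {ϖ : ℚ} (hϖ : (ϖ : ℝ) * W.realPeriodRat = plusPeriod f)
    {Lsharp Lflat : IwasawaAlgebra p} (hSP : IsSprungPair f p (W.frobeniusTrace p) Lsharp Lflat)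
    (col : Chroma) (hcol : chromaticL col Lsharp Lflat ≠ 0) (hμ : mu (chromaticL col Lsharp Lflat) = 0)
    (hlam : lam (chromaticL col Lsharp Lflat) = 1) {G : IwasawaAlgebra p}
    (hG : iwasawaToPowerSeries p G =
      PowerSeries.C (ϖ : ℚ_[p]) * iwasawaToPowerSeries p (chromaticL col Lsharp Lflat))
    (𝔭 : PrimeSpectrum (IwasawaAlgebra p)) (h𝔭 : 𝔭.asIdeal.height = 1) :
    Module.lengthAt (IwasawaAlgebra p) (IwasawaAlgebra p ⧸ Ideal.span {G}) 𝔭 ≤ 1 := by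
  classical
  -- `L^• = T · u`
  obtain ⟨⟨u, hu⟩, -, -⟩ := X8.chromaticL_eq_X_mul_unit_of_analyticRank_eq_one hX h1 hf hSP col hcol hμ hlam
  -- `ϖ ∈ ℤ_pˣ`, so `G = C(ϖ) · T · u` generates `(T)`
  have hϖ1 : ‖(ϖ : ℚ_[p])‖ = 1 := ChromaticCommonZeros.norm_periodRatio_eq_one_of_classX8 h3 W p hX f hf ϖ hϖ
  have hGeq : G = PowerSeries.C ((PadicInt.mkUnits hϖ1 : ℤ_[p]ˣ) : ℤ_[p]) * chromaticL col Lsharp Lflat := by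
    apply iwasawaToPowerSeries_injective p
    rw [hG, ChromaticCommonZeros.iwasawaToPowerSeries_C_mul, PadicInt.mkUnits_eq]
  have hunit : IsUnit (PowerSeries.C ((PadicInt.mkUnits hϖ1 : ℤ_[p]ˣ) : ℤ_[p]) * (u : IwasawaAlgebra p)) :=
    (((PadicInt.mkUnits hϖ1).isUnit).map PowerSeries.C).mul u.isUnit
  have hGX : G = (PowerSeries.X : IwasawaAlgebra p) *
      (PowerSeries.C ((PadicInt.mkUnits hϖ1 : ℤ_[p]ˣ) : ℤ_[p]) * (u : IwasawaAlgebra p)) := by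
    rw [hGeq, hu]; ring
  have hspan : Ideal.span {G} = Ideal.span {(PowerSeries.X : IwasawaAlgebra p)} := by
    rw [hGX, Ideal.span_singleton_mul_right_unit hunit]
  rw [Module.lengthAt_eq_of_linearEquiv (Submodule.quotEquivOfEq _ _ hspan) 𝔭,
    Module.lengthAt_quotient_span_singleton PowerSeries.X_prime 𝔭 h𝔭]
  by_cases hT𝔭 : (PowerSeries.X : IwasawaAlgebra p) ∈ 𝔭.asIdeal
  · rw [if_pos hT𝔭]
  · rw [if_neg hT𝔭]; exact zero_le_one

/-- **S4 at `𝔭 ∋ T`, `r_an = 1`, for a colour with certificate `(μ, λ)(L^•) = (0, 1)`** — CONTROL + the simple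
zero. In K1's binder vocabulary (cyclotomic/Honda setting, newform `f`, period ratio `ϖ`, Sprung pair, colour `•`
with `L^• ≠ 0`, REAL f.g. torsion datum `D`, normalised `G`); named inputs `h3` (period unit at `3`) and `hGZK`; the
certificate `hμ`, `hlam` is displayed (per pair it is a two-engine census row; class-wide it is the analytic half of
the lead's S4a). PER COLOUR; closes nothing. [cite: Sprung2024, §5.2 Lemma 5.6 (p. 41)]
[cite: GreenbergLNM1716, §4 Lemma 4.2 (p. 103)] [cite: Sprung2017, Thm. 1.12 and Cor. 4.11]
[cite: GreenbergVatsal2000, §3, Remark 3.4] -/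
theorem stub_cyclotomicLower_at_T_of_cert (h3 : realPeriodRat_eq_unit_mul_plusPeriod_three)
    (hGZK : rank_eq_analyticRank_of_analyticRank_le_one)
    (W : WeierstrassCurve ℚ) [W.IsElliptic] [W.IsGloballyMinimal] (p : ℕ) [Fact p.Prime]
    (hX : ClassX8 W p) (h1 : W.analyticRank = 1)
    (κ : ZpExtension ℚ p) (γ : Field.absoluteGaloisGroup ℚ) (hκ : κ.IsCyclotomic) (hγ : κ.IsTopGenerator γ)
    (hcv : IsCyclotomicVariable p γ) (v : HeightOneSpectrum (𝓞 ℚ)) (hv : (p : 𝓞 ℚ) ∈ v.asIdeal)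
    (g : Field.absoluteGaloisGroup (v.adicCompletion ℚ))
    (hg : κ.IsTopGenerator (resGalOfEmb (closureEmb (K := ℚ) (v.adicCompletion ℚ)) g))
    (cneg : localPoints W (v.adicCompletion ℚ)) (c : ℕ → localPoints W (v.adicCompletion ℚ))
    (hH : IsHondaSystem κ (closureEmb (K := ℚ) (v.adicCompletion ℚ)) W (W.frobeniusTrace p) g cneg c)
    {N : ℕ} [NeZero N] {f : CuspForm (Gamma0 N) 2} (hf : IsNewformOf W f)
    {ϖ : ℚ} (hϖ : (ϖ : ℝ) * W.realPeriodRat = plusPeriod f)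
    {Lsharp Lflat : IwasawaAlgebra p} (hSP : IsSprungPair f p (W.frobeniusTrace p) Lsharp Lflat)
    (col : Chroma) (hcol : chromaticL col Lsharp Lflat ≠ 0) (hμ : mu (chromaticL col Lsharp Lflat) = 0)
    (hlam : lam (chromaticL col Lsharp Lflat) = 1)
    (D : SharpFlatSelmerDualData W κ γ (closureEmb (K := ℚ) (v.adicCompletion ℚ)) (W.frobeniusTrace p) g c col)
    [Module.Finite (IwasawaAlgebra p) D.X] (hXt : Module.IsTorsion (IwasawaAlgebra p) D.X)
    {G : IwasawaAlgebra p}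
    (hG : iwasawaToPowerSeries p G =
      PowerSeries.C (ϖ : ℚ_[p]) * iwasawaToPowerSeries p (chromaticL col Lsharp Lflat))
    (𝔭 : PrimeSpectrum (IwasawaAlgebra p)) (h𝔭 : 𝔭.asIdeal.height = 1)
    (hT : (PowerSeries.X : IwasawaAlgebra p) ∈ 𝔭.asIdeal) :
    Module.lengthAt (IwasawaAlgebra p) (IwasawaAlgebra p ⧸ Ideal.span {G}) 𝔭 ≤
      Module.lengthAt (IwasawaAlgebra p) D.X 𝔭 :=
  stub_cyclotomicLower_at_T_of_lengthAt_le_one hGZK W p hX h1 κ γ hκ hγ hcv v hv g hg cneg c hH col D hXt G 𝔭 h𝔭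
    hT (lengthAt_quotient_normalised_le_one_of_cert h3 W p hX h1 hf hϖ hSP col hcol hμ hlam hG 𝔭 h𝔭)

/-! ### §3 S4 at `(T)`, analytic rank zero: vacuous -/

/-- **At `r_an = 0`, «`(T)` is a common zero» is contradictory, so S4's inequality at `𝔭 ∋ T` holds vacuously**:
a Néron-normalised `G^•` has non-zero constant term at analytic rank zero
(`ChromaticCommonZerosRankZero.normalised_notMem_of_X_mem`), hence cannot lie in a height-one prime containing `T`.
Stated with the conclusion of stub S4 for an arbitrary module `X` in place of `D.X`. [cite: Sprung2012, Prop. 6.14 (p. 1498)]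
[cite: Sprung2017, Cor. 4.11 (table of special values)] -/
theorem stub_cyclotomicLower_at_T_of_analyticRank_eq_zero
    (W : WeierstrassCurve ℚ) [W.IsElliptic] [W.IsGloballyMinimal] (p : ℕ) [Fact p.Prime]
    (hX : ClassX8 W p) (h0 : W.analyticRank = 0) {N : ℕ} [NeZero N] {f : CuspForm (Gamma0 N) 2}
    (hf : IsNewformOf W f) {ϖ : ℚ} (hϖ : (ϖ : ℝ) * W.realPeriodRat = plusPeriod f)
    {Lsharp Lflat : IwasawaAlgebra p} (hSP : IsSprungPair f p (W.frobeniusTrace p) Lsharp Lflat)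
    (col : Chroma) {G : IwasawaAlgebra p}
    (hG : iwasawaToPowerSeries p G =
      PowerSeries.C (ϖ : ℚ_[p]) * iwasawaToPowerSeries p (chromaticL col Lsharp Lflat))
    (X : Type*) [AddCommGroup X] [Module (IwasawaAlgebra p) X]
    (𝔭 : PrimeSpectrum (IwasawaAlgebra p)) (h𝔭 : 𝔭.asIdeal.height = 1)
    (hT : (PowerSeries.X : IwasawaAlgebra p) ∈ 𝔭.asIdeal) (hG𝔭 : G ∈ 𝔭.asIdeal) :
    Module.lengthAt (IwasawaAlgebra p) (IwasawaAlgebra p ⧸ Ideal.span {G}) 𝔭 ≤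
      Module.lengthAt (IwasawaAlgebra p) X 𝔭 :=
  absurd hG𝔭 (ChromaticCommonZerosRankZero.normalised_notMem_of_X_mem W p hX h0 hf hϖ hSP col hG 𝔭 h𝔭 hT)

end Summit.BirchSwinnertonDyer.BirchSwinnertonDyer.Theorems.ChromaticCommonZerosControlAtT

end
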